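import Literature.Probability.RandomPlanarGeometry.SAWStripTMAt
import HarnessLib

/-!
# Evaluations of the strip transfer matrix at fugacity `347/1250 = 0.2776` (spans 2–5, 81 rows) (`native_decide`)

Topic `Literature/Probability/RandomPlanarGeometry`. Compiled evaluations of the fixed-point weighted counts
`StripTM.dpAt 347 1250 l 40 (2^64) 81` (`SAWStripTMAt.lean`: irreducible bridges of span `l` in the `l × 81` grid
with start row `40`, weight `⌊2⁶⁴ (347/1250)^{|s|}⌋` summed with rounding down) for `l = 2, 3, 4, 5` — the span-`l`
contributions to the TILTED Kraft sum `Σ_s x^{|s|} y^{span s}` at `(x, y) = (347/1250, 2)` used by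
`SAWPulledFreeEnergyZ2Sharp.lean` (the pulled-SAW free-energy enclosure at force `y = 2`). Method: Kesten (1963) §4,
Jensen (2004) §2 eq. (4). The only non-standard axiom is `Lean.ofReduceBool` (`native_decide`, declared
`computational`).

## References

* I. Jensen, *Improved lower bounds on the connective constants for two-dimensional self-avoiding
  walks*, J. Phys. A 37 (2004) 11521–11529, §2 [Jensen2004SAWLowerBounds].
-/

namespace Literature.Probability.RandomPlanarGeometry.SAW.StripTM

/-- Span 2 at fugacity `347/1250` (`/ 2⁶⁴ = 0.00382189`). [cite: Jensen2004SAWLowerBounds, §2] -/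
theorem dpAt_two_3602 : dpAt 347 1250 2 40 (2 ^ 64) 81 = 70501418536528061 := by native_decide

/-- Span 3 at fugacity `347/1250` (`/ 2⁶⁴ = 0.000317217`). [cite: Jensen2004SAWLowerBounds, §2] -/
theorem dpAt_three_3602 : dpAt 347 1250 3 40 (2 ^ 64) 81 = 5851622704300709 := by native_decide

/-- Span 4 at fugacity `347/1250` (`/ 2⁶⁴ = 0.0000296644`). [cite: Jensen2004SAWLowerBounds, §2] -/
theorem dpAt_four_3602 : dpAt 347 1250 4 40 (2 ^ 64) 81 = 547212197125938 := by native_decide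

/-- Span 5 at fugacity `347/1250` (`/ 2⁶⁴ = 0.00000299035`). [cite: Jensen2004SAWLowerBounds, §2] -/
theorem dpAt_five_3602 : dpAt 347 1250 5 40 (2 ^ 64) 81 = 55162250387151 := by native_decide

end Literature.Probability.RandomPlanarGeometry.SAW.StripTM
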